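import Summits.Ventures.HSemireg.WedgeHankelRecurrenceGaussChebyshevCoprimeGapTwo

/-!
# Venture HSemireg — **IDEAL-THEORETIC COPRIMALITY IN THE CLASSICAL FAMILIES**: for every positive symmetric recurrence over `ℝ` (`a ≡ 0`, `b > 0`) **`IsCoprime q_{n+2} q_n ⟺ n even`** (N447 +
# `q_n(0)` from N427), and consecutive members are always coprime; instances: **Hermite `IsCoprime He_{n+2} He_n ⟺ n even`** (Mathlib's `Polynomial.hermite` over `ℝ`), **Legendre**,
# **Gegenbauer**, plus consecutive coprimality for Hermite, Legendre, Gegenbauer and **Laguerre**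

HONEST FRAMING. Part of the Lean index of the computation cell `pub-hsemireg` (seat p10 gen 47, Sunday typer «UNIFORM-IN-n»).  Polynomial algebra over `ℝ` only (Mathlib `IsCoprime`); no variety, no
cohomology theory, no sheaf, no Ext group and no semiregularity map is constructed here; nothing here says that HC / HC_CM / HC_AV holds; no Literature fact (unproved `Prop`) is declared or used.
Custodian versions as in `WedgeHankelSiegelIdeal` (1/3).
SOURCES (cited).  G. Szegő, *Orthogonal Polynomials*, §3.3, (4.7.4), (5.5.5); T. S. Chihara, *An Introduction to Orthogonal Polynomials* (1978), Ch. I Thm 5.3; P. C. Gibson, J. Approx. Theory 105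
(2000) 129–132; K. Driver, M. E. Muldoon, J. Approx. Theory 193 (2015) 89–98.  COROLLARIES typed here of N447 ∕ N427.
PROOF TYPED HERE.  N447 `recurrence_isCoprime_gap_two_iff`, `recurrence_isCoprime_succ_real`; N427 `recurrence_eval_zero_of_diag_zero`; §11xx `hermite_eq_recurrence`, `recurrence_of_coefficients`.
DEDUP DISCLOSURE (`rg -n -i 'isCoprime' Summits/Ventures/HSemireg/WedgeHankelRecurrenceGauss*`, 2026-09-04): N443, N445–N447, N450 (Chebyshev ∕ general); 0 hits for the 8 names below.

WHAT IS IN THE TREE.  N447, N450 (coprimality lemmas); N427 (`q_{2m}(0)`, `q_{2m+1}(0)`); N437 (Legendre values); §11xx Hermite ∕ Laguerre ∕ Gegenbauer recurrence conventions.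
THIS FILE (namespace `Summit.Ventures.HSemireg.Wedge.HankelOuter` continued; CHAINED on N450; 0 definitions):
* §1216 **`symmetric_recurrence_isCoprime_gap_two_iff`**, **`hermite_isCoprime_gap_two_iff`**, `hermite_isCoprime_succ`, `legendre_isCoprime_gap_two_iff`, `legendre_isCoprime_succ`,
  `gegenbauer_isCoprime_gap_two_iff`, `gegenbauer_isCoprime_succ`, `laguerre_isCoprime_succ`.
CAVEATS.  Real coefficients (positivity of `b`); the classical families enter through the chapter recurrences (`hermite_eq_recurrence` identifies Mathlib's `hermite`).  Nothing Ext-side.  New names only.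
-/

open Module Polynomial
open scoped Matrix Polynomial

namespace Summit.Ventures.HSemireg.Wedge.HankelOuter

/-! ## §1216. Coprimality two steps apart in the classical families -/

/-- **Positive symmetric recurrence: `IsCoprime q_{n+2} q_n ⟺ n even`** (in `ℝ[X]`). [Szegő §3.3; Gibson 2000; this file, §1216] -/
theorem symmetric_recurrence_isCoprime_gap_two_iff {q : ℕ → ℝ[X]} {a b : ℕ → ℝ} (hq0 : q 0 = 1) (hq1 : q 1 = Polynomial.X - C (a 0))
    (hrec : ∀ n, q (n + 2) = (Polynomial.X - C (a (n + 1))) * q (n + 1) - C (b (n + 1)) * q n) (ha : ∀ n, a n = 0) (hb : ∀ j, 0 < b j) (n : ℕ) :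
    IsCoprime (q (n + 2)) (q n) ↔ Even n := by
  rw [recurrence_isCoprime_gap_two_iff hq0 hrec (fun j => (hb (j + 1)).ne') n, ha]
  obtain ⟨m, rfl | rfl⟩ := Nat.even_or_odd' n
  · rw [(recurrence_eval_zero_of_diag_zero hq0 hq1 hrec ha m).2]
    exact ⟨fun _ => ⟨m, by ring⟩, fun _ => mul_ne_zero (pow_ne_zero _ (by norm_num)) (Finset.prod_ne_zero_iff.2 fun k _ => (hb _).ne')⟩
  · rw [(recurrence_eval_zero_of_diag_zero hq0 hq1 hrec ha m).1]
    exact ⟨fun h => absurd rfl h, fun h => absurd h (by rw [Nat.not_even_iff_odd]; exact ⟨m, rfl⟩)⟩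

/-- **HERMITE: `IsCoprime He_{n+2} He_n ⟺ n even`** in `ℝ[X]` (Mathlib's probabilists' `hermite`). [Szegő (5.5.5); Driver–Muldoon 2015; this file, §1216] -/
theorem hermite_isCoprime_gap_two_iff (n : ℕ) :
    IsCoprime ((Polynomial.hermite (n + 2)).map (Int.castRingHom ℝ)) ((Polynomial.hermite n).map (Int.castRingHom ℝ)) ↔ Even n := by
  obtain ⟨q, hq0, hq1, hrec⟩ := recurrence_of_coefficients (fun _ => (0 : ℝ)) (fun j => ((max j 1 : ℕ) : ℝ))
  have hb1 : ∀ m : ℕ, (fun j => ((max j 1 : ℕ) : ℝ)) (m + 1) = (m : ℝ) + 1 := fun m => by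
    simp only [show max (m + 1) 1 = m + 1 from max_eq_left (Nat.le_add_left 1 m), Nat.cast_add, Nat.cast_one]
  have hq := hermite_eq_recurrence (q := q) (a := fun _ => (0 : ℝ)) (b := fun j => ((max j 1 : ℕ) : ℝ)) hq0 hq1 hrec (fun _ => rfl) hb1
  rw [← hq (n + 2), ← hq n]
  exact symmetric_recurrence_isCoprime_gap_two_iff (q := q) (a := fun _ => (0 : ℝ)) (b := fun j => ((max j 1 : ℕ) : ℝ)) hq0 hq1 hrec (fun _ => rfl) (fun j => by
    show (0 : ℝ) < ((max j 1 : ℕ) : ℝ)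
    exact_mod_cast lt_of_lt_of_le Nat.one_pos (le_max_right j 1)) n

/-- **HERMITE: consecutive `He_{n+1}`, `He_n` are coprime in `ℝ[X]`.** [Szegő §3.3; this file, §1216] -/
theorem hermite_isCoprime_succ (n : ℕ) : IsCoprime ((Polynomial.hermite (n + 1)).map (Int.castRingHom ℝ)) ((Polynomial.hermite n).map (Int.castRingHom ℝ)) := by
  obtain ⟨q, hq0, hq1, hrec⟩ := recurrence_of_coefficients (fun _ => (0 : ℝ)) (fun j => ((max j 1 : ℕ) : ℝ))
  have hb1 : ∀ m : ℕ, (fun j => ((max j 1 : ℕ) : ℝ)) (m + 1) = (m : ℝ) + 1 := fun m => by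
    simp only [show max (m + 1) 1 = m + 1 from max_eq_left (Nat.le_add_left 1 m), Nat.cast_add, Nat.cast_one]
  have hq := hermite_eq_recurrence (q := q) (a := fun _ => (0 : ℝ)) (b := fun j => ((max j 1 : ℕ) : ℝ)) hq0 hq1 hrec (fun _ => rfl) hb1
  rw [← hq (n + 1), ← hq n]
  exact recurrence_isCoprime_succ_real (q := q) (a := fun _ => (0 : ℝ)) (b := fun j => ((max j 1 : ℕ) : ℝ)) hq0 hrec (fun j => by
    show (0 : ℝ) < ((max j 1 : ℕ) : ℝ)
    exact_mod_cast lt_of_lt_of_le Nat.one_pos (le_max_right j 1)) n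

/-- **LEGENDRE: `IsCoprime P̂_{n+2} P̂_n ⟺ n even`** (chapter recurrence `a ≡ 0`, `b_k = k²∕(4k²−1)`). [Szegő (4.7.4); Gibson 2000; this file, §1216] -/
theorem legendre_isCoprime_gap_two_iff {q : ℕ → ℝ[X]} {a b : ℕ → ℝ} (hq0 : q 0 = 1) (hq1 : q 1 = Polynomial.X - C (a 0))
    (hrec : ∀ n, q (n + 2) = (Polynomial.X - C (a (n + 1))) * q (n + 1) - C (b (n + 1)) * q n) (ha : ∀ n, a n = 0)
    (hb : ∀ n, b (n + 1) = ((n : ℝ) + 1) ^ 2 / (4 * ((n : ℝ) + 1) ^ 2 - 1)) (hb0 : 0 < b 0) (n : ℕ) : IsCoprime (q (n + 2)) (q n) ↔ Even n := by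
  refine symmetric_recurrence_isCoprime_gap_two_iff hq0 hq1 hrec ha (fun j => ?_) n
  rcases j with _ | k
  · exact hb0
  · rw [hb]
    have hk : (0 : ℝ) ≤ k := Nat.cast_nonneg k
    have hD : (0 : ℝ) < 4 * ((k : ℝ) + 1) ^ 2 - 1 := by nlinarith
    positivity

/-- **LEGENDRE: consecutive `P̂_{n+1}`, `P̂_n` are coprime.** [Szegő §3.3; this file, §1216] -/
theorem legendre_isCoprime_succ {q : ℕ → ℝ[X]} {a b : ℕ → ℝ} (hq0 : q 0 = 1)
    (hrec : ∀ n, q (n + 2) = (Polynomial.X - C (a (n + 1))) * q (n + 1) - C (b (n + 1)) * q n)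
    (hb : ∀ n, b (n + 1) = ((n : ℝ) + 1) ^ 2 / (4 * ((n : ℝ) + 1) ^ 2 - 1)) (hb0 : 0 < b 0) (n : ℕ) : IsCoprime (q (n + 1)) (q n) := by
  refine recurrence_isCoprime_succ_real hq0 hrec (fun j => ?_) n
  rcases j with _ | k
  · exact hb0
  · rw [hb]
    have hk : (0 : ℝ) ≤ k := Nat.cast_nonneg k
    have hD : (0 : ℝ) < 4 * ((k : ℝ) + 1) ^ 2 - 1 := by nlinarith
    positivity

/-- **GEGENBAUER (`λ > 0`): `IsCoprime Ĉ^{(λ)}_{n+2} Ĉ^{(λ)}_n ⟺ n even`.** [Szegő §3.3, (4.7.17); this file, §1216] -/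
theorem gegenbauer_isCoprime_gap_two_iff {q : ℕ → ℝ[X]} {a b : ℕ → ℝ} {lam : ℝ} (hq0 : q 0 = 1) (hq1 : q 1 = Polynomial.X - C (a 0))
    (hrec : ∀ n, q (n + 2) = (Polynomial.X - C (a (n + 1))) * q (n + 1) - C (b (n + 1)) * q n) (ha : ∀ n, a n = 0)
    (hb : ∀ n, b (n + 1) = ((n : ℝ) + 1) * ((n : ℝ) + 2 * lam) / (4 * ((n : ℝ) + 1 + lam) * ((n : ℝ) + lam))) (hlam : 0 < lam) (hb0 : 0 < b 0) (n : ℕ) :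
    IsCoprime (q (n + 2)) (q n) ↔ Even n := by
  refine symmetric_recurrence_isCoprime_gap_two_iff hq0 hq1 hrec ha (fun j => ?_) n
  rcases j with _ | k
  · exact hb0
  · rw [hb]; have hk : (0 : ℝ) ≤ k := Nat.cast_nonneg k; positivity

/-- **GEGENBAUER (`λ > 0`): consecutive members are coprime.** [Szegő §3.3; this file, §1216] -/
theorem gegenbauer_isCoprime_succ {q : ℕ → ℝ[X]} {a b : ℕ → ℝ} {lam : ℝ} (hq0 : q 0 = 1)
    (hrec : ∀ n, q (n + 2) = (Polynomial.X - C (a (n + 1))) * q (n + 1) - C (b (n + 1)) * q n)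
    (hb : ∀ n, b (n + 1) = ((n : ℝ) + 1) * ((n : ℝ) + 2 * lam) / (4 * ((n : ℝ) + 1 + lam) * ((n : ℝ) + lam))) (hlam : 0 < lam) (hb0 : 0 < b 0) (n : ℕ) :
    IsCoprime (q (n + 1)) (q n) := by
  refine recurrence_isCoprime_succ_real hq0 hrec (fun j => ?_) n
  rcases j with _ | k
  · exact hb0
  · rw [hb]; have hk : (0 : ℝ) ≤ k := Nat.cast_nonneg k; positivity

/-- **LAGUERRE (`α > −1`): consecutive `L̂^{(α)}_{n+1}`, `L̂^{(α)}_n` are coprime** (monic recurrence `a_n = 2n+1+α`, `b_n = n(n+α)`). [Szegő §3.3, (5.1.10); this file, §1216] -/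
theorem laguerre_isCoprime_succ {L : ℕ → ℝ[X]} {a b : ℕ → ℝ} {α : ℝ} (hL0 : L 0 = 1)
    (hLrec : ∀ n, L (n + 2) = (Polynomial.X - C (a (n + 1))) * L (n + 1) - C (b (n + 1)) * L n)
    (hb : ∀ n, b (n + 1) = ((n : ℝ) + 1) * ((n : ℝ) + 1 + α)) (hα : -1 < α) (hb0 : 0 < b 0) (n : ℕ) : IsCoprime (L (n + 1)) (L n) := by
  refine recurrence_isCoprime_succ_real hL0 hLrec (fun j => ?_) n
  rcases j with _ | k
  · exact hb0
  · rw [hb]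
    have hk : (0 : ℝ) ≤ k := Nat.cast_nonneg k
    have h1 : (0 : ℝ) < (k : ℝ) + 1 + α := by linarith
    positivity

end Summit.Ventures.HSemireg.Wedge.HankelOuter
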